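import Summits.ValiantsHypothesis.ValiantsHypothesis.Theorems.TwoProducts.RankThreeAffineOLMColumnsResidue
import Summits.ValiantsHypothesis.ValiantsHypothesis.Theorems.TwoProducts.WronskianSylvester

/-!
# OLM slot, column ladder part 3: the canonical pivot columns ARE flag toric Wronskians — «(TW-count) ⟸ (TW-flag)» typed

With val-port-1 g5's ✓ `Wronskian.wronskian_sylvester` (Sylvester/Frobenius for the Wronskian of an arbitrary derivation, p712036) the canonical
pivot columns of ✓ `…RankThreeAffineOLMColumnsResidue` (`canCol u e j j`, ψ-FREE) are identified, when no flag Wronskian vanishes («the u-free monomials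
`X^{e_0..e_{K-1}}` are ℂ(u)-linearly independent» — the general case reduces to it on paper by a basis choice and clearing denominators, scratch report
44e1e76fa8779622 §1; NOT formalised here), with PRODUCTS OF FLAG TORIC WRONSKIANS `W_l := W_{J(·,u)}(X^{e_0},…,X^{e_{l−1}})`:
★ `canCol_eq_flag`: `canCol u e j i = colFlagConst u e j · W_{J(·,u)}(X^{e_0},…,X^{e_{j−1}}, X^{e_i})`, `colFlagConst (j+1) = colFlagConst j ^ 2 · W_j`
(step: `newCol(c·A, c·B) = c²·newCol(A,B)` and `newCol(W(f⃗,g), W(f⃗,h)) = W(f⃗,g,h)·W(f⃗)` = ✓ `wronskian_sylvester` for `D = jacDer u`).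
Hence ★ `Eset_canCol_subset_flag` (✓ `ostrowski`): `Eset σ (canCol u e j j) ⊆ ⋃_{l ≤ j+1} Eset σ W_l`, so `colResidue σ u e ≤ K·Σ_{l≤K} |Eset σ W_l|`, and
★ `olmColumns_nv_le_of_twFlag`: a bound `Q K t` on the edge directions of the FLAG Wronskians (hypothesis shape `TWFlagBound Q`, NOT asserted) gives
`nv (Σ_i X^{e_i}·ψ_i(u)) ≤ 2·(3K(t²+t) + 3K + 3K·(K+1)·Q K t) + 4` for ALL columns ψ.  ✓ (W1) `toricW_card_Eset_ray_le` (p711636) IS such a bound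
(`t²+t`) for flags on ONE resonance line; several lines / merged resonances stay OPEN (residue sentence of record, crit-8 g5 #98).
HONEST SCOPE OF `hW` (val-idea-crit-8 g5 #100 (C3-b)): `hW` is NOT a null condition in the OLM slot — the flags vanish iff the monomial columns are
linearly dependent over the `J(·,u)`-constants, and that HAPPENS generically once the column set is large against `u`: e.g. `u = x + y`, columns
`{1, x, y}`: `x + y − u·1 = 0`, `W(1, x, y) = 0` (the third row of `(f, Df, D²f)` is a combination of the first two); in general the columns
`{X^s : s ∈ supp u} ∪ {1}` are ℂ[u]-dependent, so for the full OLM triangle with `m ≥ deg u` the hypothesis `hW` ALWAYS fails and `canCol`'s skip branch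
fires.  So (COL-3) is honestly «the INDEPENDENT-COLUMNS case».  The LOAD-BEARING NEXT ITEM (COL-4), not a remark: the reduction of the scratch report
44e1e76fa8779622 §1 — choose a ℂ(u)-basis among the columns, rewrite the other columns over it, and clear denominators by a `J(·,u)`-constant `d(u)`
(whose Newton edges lie in `Xc σ u`, ✓ `Eset_aeval_subset_Xc`), so that the general column sum is `d(u)⁻¹ ·` an independent-columns sum with K′ < K.
DISCHARGES of `TWFlagBound`: ✓ (W1) `toricW_card_Eset_ray_le` (p711636) gives `Q = t²+t` on single-class flags (all `e i` on one line `e₀ + ℕq`); the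
conjectural off-merge discharge is C2 of NOTE e7f9f5e1cec2d957 (no-merge product formula, 23/23 exact checks); merged resonances stay OPEN.
`newCol_eq_jacDer` is the `n = 2` instance of ✓ `Literature.LinearAlgebra.Matrix.wronskian (⇑D)` written out (cited, not a new Wronskian lemma).
HONEST LABEL: bookkeeping / typed reduction on the OPEN rung 3-AFF (side ladder, crux `stmt-ValiantsHypothesis-5906` `TwoProducts`); NOT γ; `OLMLaw` /
`RankThreeAffineLaw(Exp)` / `TwoProducts` / PCB / `ResidualLawV25` UNMOVED; 0 summit distance; VP ≠ VNP is NOT proved.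
`--kind definition --supports stmt-ValiantsHypothesis-5906 --as helper` (val-port-4 g5; critic of record val-idea-crit-8 g5).  No instances, no notation,
no named facts. [folklore]
-/

noncomputable section
set_option linter.dupNamespace false

namespace Summit.ValiantsHypothesis.ValiantsHypothesis.Theorems.TwoProducts.RankTwoJacobian

open scoped BigOperators Pointwise
open MvPolynomial
open Literature.LinearAlgebra.Matrix (wronskianMatrix wronskian wronskianMatrix_apply wronskian_def)
open Summit.ValiantsHypothesis.ValiantsHypothesis.Theorems.TwoProducts.Wronskian (wronskian_sylvester)

section TowerKernel
open scoped Classical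

/-! ### §1 Exponents extended to `ℕ`, the flags, the constants -/

/-- the exponent sequence extended by `0` beyond `K`. -/
def eExt {K : ℕ} (e : Fin K → Expo) (k : ℕ) : Expo := if h : k < K then e ⟨k, h⟩ else 0

/-- `eExt e j = e ⟨j, _⟩` below `K`. [folklore] -/
theorem eExt_of_lt {K : ℕ} (e : Fin K → Expo) {j : ℕ} (h : j < K) : eExt e j = e ⟨j, h⟩ := by
  unfold eExt; rw [dif_pos h]

/-- `eExt e i = e i` on `Fin K`. [folklore] -/
theorem eExt_fin {K : ℕ} (e : Fin K → Expo) (i : Fin K) : eExt e i = e i :=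
  eExt_of_lt e i.isLt

/-- the FLAG of the first `l` monomials: `colFlag e l = (X^{e_0}, …, X^{e_{l−1}})`. -/
def colFlag {K : ℕ} (e : Fin K → Expo) (l : ℕ) : Fin l → Poly2 := fun k => monomial (eExt e k) (1 : ℂ)

/-- appending the next monomial to a flag gives the next flag. [folklore] -/
theorem snoc_colFlag {K : ℕ} (e : Fin K → Expo) (j : ℕ) :
    (Fin.snoc (colFlag e j) (monomial (eExt e j) (1 : ℂ)) : Fin (j + 1) → Poly2) = colFlag e (j + 1) := by
  funext k
  refine Fin.lastCases ?_ (fun k' => ?_) k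
  · rw [Fin.snoc_last]; unfold colFlag; simp
  · rw [Fin.snoc_castSucc]; unfold colFlag; simp

/-- the ladder constants: `c 0 = 1`, `c (j+1) = c j ^ 2 · W_j`. -/
def colFlagConst {K : ℕ} (u : Poly2) (e : Fin K → Expo) : ℕ → Poly2
  | 0 => 1
  | j + 1 => colFlagConst u e j ^ 2 * wronskian (⇑(jacDer u)) (colFlag e j)

/-! ### §2 `newCol` is the 2-Wronskian; scaling; the Sylvester step -/

/-- `newCol u A B = A·D B − B·D A` for `D = jacDer u`. [folklore] -/
theorem newCol_eq_jacDer (u A B : Poly2) : newCol u A B = A * jacDer u B - B * jacDer u A := by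
  unfold newCol; rw [jacDer_apply, jacDer_apply]

/-- scaling both columns: `newCol u (c·A) (c·B) = c² · newCol u A B`. [folklore] -/
theorem newCol_smul (u c A B : Poly2) : newCol u (c * A) (c * B) = c ^ 2 * newCol u A B := by
  unfold newCol
  rw [jac_mul_left c B u, jac_mul_left c A u]
  ring

/-- ★ THE SYLVESTER STEP for `D = J(·,u)`: `newCol u (W(f⃗,g)) (W(f⃗,h)) = W(f⃗) · W(f⃗,g,h)`. -/
theorem newCol_wronskian {n : ℕ} (u : Poly2) (f : Fin n → Poly2) (g h : Poly2) :
    newCol u (wronskian (⇑(jacDer u)) (Fin.snoc f g)) (wronskian (⇑(jacDer u)) (Fin.snoc f h)) =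
      wronskian (⇑(jacDer u)) f * wronskian (⇑(jacDer u)) (Fin.snoc (Fin.snoc f g : Fin (n + 1) → Poly2) h) := by
  rw [newCol_eq_jacDer, mul_comm (wronskian (⇑(jacDer u)) f), wronskian_sylvester (jacDer u) f g h]
  ring

/-! ### §3 The identification -/

/-- ★ **CANONICAL PIVOT COLUMNS = FLAG WRONSKIANS:** if no flag Wronskian `W_l` (`l ≤ K`) vanishes, then for all `j ≤ K` and all `i`,
`canCol u e j i = colFlagConst u e j · W_{J(·,u)}(X^{e_0},…,X^{e_{j−1}}, X^{e_i})` and `colFlagConst u e j ≠ 0`. -/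
theorem canCol_eq_flag {K : ℕ} (u : Poly2) (e : Fin K → Expo)
    (hW : ∀ l, l ≤ K → wronskian (⇑(jacDer u)) (colFlag e l) ≠ 0) :
    ∀ j, j ≤ K → colFlagConst u e j ≠ 0 ∧ ∀ i : Fin K,
      canCol u e j i = colFlagConst u e j * wronskian (⇑(jacDer u)) (Fin.snoc (colFlag e j) (monomial (e i) (1 : ℂ))) := by
  intro j
  induction j with
  | zero =>
    intro _
    refine ⟨one_ne_zero, fun i => ?_⟩
    show monomial (e i) 1 = 1 * wronskian (⇑(jacDer u)) (Fin.snoc (colFlag e 0) (monomial (e i) (1 : ℂ)))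
    rw [one_mul, wronskian_def, Matrix.det_fin_one, wronskianMatrix_apply]
    simp [Fin.snoc]
  | succ j ih =>
    intro hj
    obtain ⟨hc, hcol⟩ := ih (by omega)
    have hjK : j < K := by omega
    -- the pivot at step `j` is `c_j · W_{j+1} ≠ 0`
    have hpiv : canCol u e j ⟨j, hjK⟩ = colFlagConst u e j * wronskian (⇑(jacDer u)) (colFlag e (j + 1)) := by
      rw [hcol ⟨j, hjK⟩, ← eExt_of_lt e hjK, snoc_colFlag]
    have hpiv0 : canCol u e j ⟨j, hjK⟩ ≠ 0 := by
      rw [hpiv]; exact mul_ne_zero hc (hW (j + 1) (by omega))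
    have hc' : colFlagConst u e (j + 1) ≠ 0 := by
      show colFlagConst u e j ^ 2 * wronskian (⇑(jacDer u)) (colFlag e j) ≠ 0
      exact mul_ne_zero (pow_ne_zero 2 hc) (hW j (by omega))
    refine ⟨hc', fun i => ?_⟩
    have hstep : canCol u e (j + 1) i = newCol u (canCol u e j ⟨j, hjK⟩) (canCol u e j i) := by
      show (if ∃ hj : j < K, canCol u e j ⟨j, hj⟩ = 0 then canCol u e j i
        else if hj : j < K then newCol u (canCol u e j ⟨j, hj⟩) (canCol u e j i) else canCol u e j i) = _
      rw [if_neg (fun ⟨_, h⟩ => hpiv0 h), dif_pos hjK]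
    rw [hstep, hcol ⟨j, hjK⟩, hcol i, newCol_smul, ← eExt_of_lt e hjK, newCol_wronskian, snoc_colFlag]
    show _ = colFlagConst u e j ^ 2 * wronskian (⇑(jacDer u)) (colFlag e j) * _
    ring

/-! ### §4 The residue through the flags -/

/-- edge directions of the constants: `Eset σ (c_j) ⊆ ⋃_{l<j} Eset σ W_l`. [folklore] -/
theorem Eset_colFlagConst_subset {σ : ℝ} (hσ : σ = 1 ∨ σ = -1) {K : ℕ} (u : Poly2) (e : Fin K → Expo)
    (hW : ∀ l, l ≤ K → wronskian (⇑(jacDer u)) (colFlag e l) ≠ 0) :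
    ∀ j, j ≤ K → Eset σ (colFlagConst u e j) ⊆ (Finset.range j).biUnion (fun l => Eset σ (wronskian (⇑(jacDer u)) (colFlag e l))) := by
  intro j
  induction j with
  | zero =>
    intro _
    show Eset σ (1 : Poly2) ⊆ _
    rw [← C_1, Eset_C]; exact Finset.empty_subset _
  | succ j ih =>
    intro hj μ hμ
    have hc : colFlagConst u e j ≠ 0 := (canCol_eq_flag u e hW j (by omega)).1
    have hedge := (mem_Eset hσ).mp hμ
    change IsEdgeDir (dir σ μ) (colFlagConst u e j ^ 2 * wronskian (⇑(jacDer u)) (colFlag e j)) at hedge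
    rcases (ostrowski _ _ _ (pow_ne_zero 2 hc) (hW j (by omega))).mp hedge with h | h
    · have h' : μ ∈ Eset σ (colFlagConst u e j) := Eset_pow_subset hσ _ 2 ((mem_Eset hσ).mpr h)
      have := ih (by omega) h'
      rw [Finset.mem_biUnion] at this ⊢
      obtain ⟨l, hl, hml⟩ := this
      exact ⟨l, Finset.mem_range.mpr (by have := Finset.mem_range.mp hl; omega), hml⟩
    · rw [Finset.mem_biUnion]
      exact ⟨j, Finset.mem_range.mpr (by omega), (mem_Eset hσ).mpr h⟩

/-- ★ THE PIVOT COLUMN'S EDGE DIRECTIONS LIE IN THE FLAG WRONSKIANS': `Eset σ (canCol u e j j) ⊆ ⋃_{l ≤ j+1} Eset σ W_l`. -/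
theorem Eset_canCol_subset_flag {σ : ℝ} (hσ : σ = 1 ∨ σ = -1) {K : ℕ} (u : Poly2) (e : Fin K → Expo)
    (hW : ∀ l, l ≤ K → wronskian (⇑(jacDer u)) (colFlag e l) ≠ 0) (j : Fin K) :
    Eset σ (canCol u e j j) ⊆ (Finset.range ((j : ℕ) + 2)).biUnion (fun l => Eset σ (wronskian (⇑(jacDer u)) (colFlag e l))) := by
  obtain ⟨hc, hcol⟩ := canCol_eq_flag u e hW j (le_of_lt j.isLt)
  intro μ hμ
  rw [hcol j, ← eExt_fin e j, snoc_colFlag] at hμ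
  have hedge := (mem_Eset hσ).mp hμ
  rcases (ostrowski _ _ _ hc (hW (j + 1) j.isLt)).mp hedge with h | h
  · have := Eset_colFlagConst_subset hσ u e hW j (le_of_lt j.isLt) ((mem_Eset hσ).mpr h)
    rw [Finset.mem_biUnion] at this ⊢
    obtain ⟨l, hl, hml⟩ := this
    exact ⟨l, Finset.mem_range.mpr (by have := Finset.mem_range.mp hl; omega), hml⟩
  · rw [Finset.mem_biUnion]
    exact ⟨j + 1, Finset.mem_range.mpr (by omega), (mem_Eset hσ).mpr h⟩

/-- (TW-flag) as a HYPOTHESIS SHAPE (NOT asserted; the only Prop-`def` of this file): a bound on the edge directions of every flag toric Wronskian of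
the monomials.  ✓ `toricW_card_Eset_ray_le` (p711636) provides it (`t²+t`) when the flag lies on ONE resonance line. -/
def TWFlagBound (Q : ℕ → ℕ → ℕ) : Prop :=
  ∀ (σ : ℝ), (σ = 1 ∨ σ = -1) → ∀ (K t : ℕ) (u : Poly2), u.support.card ≤ t → ∀ (e : Fin K → Expo) (l : ℕ), l ≤ K →
    (Eset σ (wronskian (⇑(jacDer u)) (colFlag e l))).card ≤ Q K t

/-- ★ `colResidue σ u e ≤ K·((K+1)·Q K t)` under (TW-flag) and non-vanishing flags. -/
theorem colResidue_le_of_twFlag {Q : ℕ → ℕ → ℕ} (hQ : TWFlagBound Q) {σ : ℝ} (hσ : σ = 1 ∨ σ = -1) {K t : ℕ} (u : Poly2)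
    (hu : u.support.card ≤ t) (e : Fin K → Expo) (hW : ∀ l, l ≤ K → wronskian (⇑(jacDer u)) (colFlag e l) ≠ 0) :
    colResidue σ u e ≤ K * ((K + 1) * Q K t) := by
  unfold colResidue
  have hj : ∀ j : Fin K, (Eset σ (canCol u e j j)).card ≤ (K + 1) * Q K t := by
    intro j
    refine (Finset.card_le_card (Eset_canCol_subset_flag hσ u e hW j)).trans (Finset.card_biUnion_le.trans ?_)
    calc ∑ l ∈ Finset.range ((j : ℕ) + 2), (Eset σ (wronskian (⇑(jacDer u)) (colFlag e l))).card
        ≤ ∑ _l ∈ Finset.range ((j : ℕ) + 2), Q K t :=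
          Finset.sum_le_sum fun l hl => hQ σ hσ K t u hu e l (by have := Finset.mem_range.mp hl; have := j.isLt; omega)
      _ = ((j : ℕ) + 2) * Q K t := by rw [Finset.sum_const, Finset.card_range, smul_eq_mul]
      _ ≤ (K + 1) * Q K t := Nat.mul_le_mul_right _ (by have := j.isLt; omega)
  calc ∑ j : Fin K, (Eset σ (canCol u e j j)).card ≤ ∑ _j : Fin K, (K + 1) * Q K t := Finset.sum_le_sum fun j _ => hj j
    _ = K * ((K + 1) * Q K t) := by simp

/-- ★ **«OLM COLUMNS LAW ⟸ (TW-flag)» TYPED:** for ℂ(u)-independent monomials (no flag Wronskian vanishes) and any bound `Q` on the flags' edge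
directions, `nv (Σ_i X^{e_i}·ψ_i(u)) ≤ 2·(3K(t²+t) + 3K + 3K·(K+1)·Q K t) + 4` for ALL columns `ψ`. -/
theorem olmColumns_nv_le_of_twFlag {Q : ℕ → ℕ → ℕ} (hQ : TWFlagBound Q) (K t : ℕ) (u : Poly2) (hu : u.support.card ≤ t)
    (e : Fin K → Expo) (hW : ∀ l, l ≤ K → wronskian (⇑(jacDer u)) (colFlag e l) ≠ 0) (ψ : Fin K → Polynomial ℂ) :
    nv (∑ i, monomial (e i) (1 : ℂ) * Polynomial.aeval u (ψ i)) ≤ 2 * (3 * K * (t * t + t) + 3 * K + 3 * (K * ((K + 1) * Q K t))) + 4 := by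
  by_cases hS : (S1 u).Nonempty
  · have hX : ∀ σ : ℝ, (Xc σ u).card ≤ t * t + t :=
      fun σ => (card_Xc_le σ u).trans (Nat.add_le_add (Nat.mul_le_mul hu hu) hu)
    have h1 := card_Eset_columnSum_le_residue (σ := 1) (Or.inl rfl) hS e ψ
    have h2 := card_Eset_columnSum_le_residue (σ := -1) (Or.inr rfl) hS e ψ
    have r1 := colResidue_le_of_twFlag hQ (σ := 1) (Or.inl rfl) u hu e hW
    have r2 := colResidue_le_of_twFlag hQ (σ := -1) (Or.inr rfl) u hu e hW
    have hn := nv_le (∑ i, monomial (e i) (1 : ℂ) * Polynomial.aeval u (ψ i))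
    have a1 := hX 1; have a2 := hX (-1)
    have b1 : 3 * K * (Xc 1 u).card ≤ 3 * K * (t * t + t) := Nat.mul_le_mul_left _ a1
    have b2 : 3 * K * (Xc (-1) u).card ≤ 3 * K * (t * t + t) := Nat.mul_le_mul_left _ a2
    omega
  · -- constant carrier: `≤ K` monomials
    have huC : u = C (coeff 0 u) := eq_C_of_S1_empty hS
    have hval : ∀ i, Polynomial.aeval u (ψ i) = C ((ψ i).eval (coeff 0 u)) := fun i => by
      rw [show Polynomial.aeval u (ψ i) = Polynomial.aeval (C (coeff 0 u) : Poly2) (ψ i) by rw [← huC]]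
      exact aeval_C_eq _ _
    have hsum : ∑ i, monomial (e i) (1 : ℂ) * Polynomial.aeval u (ψ i) =
        ∑ i ∈ Finset.univ, (monomial (e i) ((ψ i).eval (coeff 0 u)) : Poly2) := by
      refine Finset.sum_congr rfl fun i _ => ?_
      rw [hval i, mul_comm, C_mul_monomial, mul_one]
    rw [hsum]
    have hK := (nv_le_card_support _).trans
      (card_support_sum_monomial_le Finset.univ e (fun i => (ψ i).eval (coeff 0 u)))
    simp only [Finset.card_univ, Fintype.card_fin] at hK
    omega

end TowerKernel

end Summit.ValiantsHypothesis.ValiantsHypothesis.Theorems.TwoProducts.RankTwoJacobian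

end
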